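import Mathlib
import Literature.Analysis.FluidPDE.Tao2016AveragedNS.BoundedEternalSolutions
import Summits.NavierStokesRegularity.NavierStokesRegularity.Theses.TaoLadderRungTwoBreak
import Summits.NavierStokesRegularity.NavierStokesRegularity.Theorems.TaoLadderRungTwoBreakNoSurvivingEternalViscBddOneUpwardFluxRung
import Summits.NavierStokesRegularity.NavierStokesRegularity.Theorems.WakeRatchetAdmissibleEternalBoundOrthantBound
import HarnessLib

/-!
# K1ᵛ(1) `TaoLadderRungTwoBreak.NoSurvivingEternalViscBddOne` (stmt-NavierStokesRegularity-20419) ON THE STRONG-ORTHANT CLASS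
# (pure Katz–Pavlović networks, containing the dyadic member): the LOGARITHMIC ACTION FLOOR with NO flux hypothesis

MODEL lattice ODEs only (Tao 2016 §4, §6.4); nothing here is a statement about the Navier–Stokes equations; no stub, crux or summit is closed
(`--supports stmt-NavierStokesRegularity-20419`).  Junction of two landed facts:

* route WakeRatchet's `WakeRatchetOrthant.physFlux_nonneg`: on a STRONG-ORTHANT table (every feed component `(A y)_i ≥ 0`, in-shell components
  `(Q x)_i ≥ 0` on `{x_i = 0}`, back-reaction diagonal — equivalently the unconditional Kamke condition `Y_{i,n} = 0 ⟹ quadTerm ≥ 0`,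
  `quasiPositive_iff_strongOrthant`) EVERY admissible eternal solution (any `ν̂ ≥ 0`) is non-negative and all its bond fluxes are `≥ 0` —
  no backscatter, ever; inviscid ones are moreover automatically `UniformBound` (`uniformBound_of_orthant`);
* this hand's upward-flux rung `not_survivingFwd_of_upwardFlux_logAction` (sign-coherent fluxes + per-shell action `≤ log(1/ε₀)/512`
  ⇒ not forward (S₁)-surviving).

Results (every spread `R`, every `0 < ε₀ < 1`, NO sign or flux hypothesis on the solution):
* `not_survivingFwd_of_orthant_logAction` — on a strong-orthant table of `InTableClass R`, a uniformly bounded admissible eternal solution (any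
  `ν̂ ≥ 0`) with per-shell actions `≤ log(1/ε₀)/512` is not forward (S₁)-surviving; `exists_action_gt_log_of_survivingFwd_orthant` — a surviving
  one pays action `> log(1/ε₀)/512` on some shell;
* `noSurvivingEternalViscBdd_rung_orthant` — the slice of the crux's predicate `NoSurvivingEternalViscBdd R 1` in binder shape (threshold `1/2`;
  extra hypotheses: Kamke condition on the table, logarithmic action budget on the solution);
* `noSurvivingEternalBdd_rung_orthant` — the (ρ0) slice WITHOUT the `UniformBound` binder (automatic on the class);
* `dyadic_not_survivingFwd_of_logAction` / `dyadic_exists_action_gt_log_of_survivingFwd` — the DYADIC MEMBER (`dyadicTable ∈ E₂(2)`): every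
  admissible inviscid eternal solution of the Katz–Pavlović chain with per-shell action `≤ log(1/ε₀)/512` is not (S₁)-surviving — survival on
  the dyadic member costs action `> log(1/ε₀)/512` per some shell, unboundedly as `ε₀ → 0`.

READING for the census of ⟨20419⟩: on pure Katz–Pavlović networks the K1ᵛ wall is EXACTLY `{sup_n ∫‖W_n‖ ≳ log(1/ε₀)}` (no backscatter is
possible there); the missing estimate on this class is an a-priori ACTION CEILING for surviving fronts (per-shell log-time width × amplitude),
which would close K1ᵛ(1) on the orthant class outright.  HONEST LABEL: (ρ0), (ρ+), ⟨20419⟩ and every NS statement remain OPEN.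
-/

noncomputable section

-- the summit and its single sub-problem share the name (CONVENTIONS §1)
set_option linter.dupNamespace false

namespace Summit.NavierStokesRegularity.NavierStokesRegularity.Theorems.NoSurvivingEternalViscBddOne.UpwardFlux

open Set Filter Topology MeasureTheory
open scoped RealInnerProductSpace
open Literature.Analysis.FluidPDE Literature.Analysis.FluidPDE.TaoCascade
open Summit.NavierStokesRegularity.NavierStokesRegularity.Theses.TaoLadderRungTwoBreak
open Summit.NavierStokesRegularity.NavierStokesRegularity.Theorems.WakeRatchetOrthant
  (physFlux_nonneg quasiPositive_iff_strongOrthant uniformBound_of_orthant quasiPositive_dyadicTable)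

/-! ## Strong-orthant tables: the action floor with no flux hypothesis -/

/-- **THE LOGARITHMIC ACTION FLOOR ON STRONG-ORTHANT TABLES** (any `ν̂ ≥ 0`).  On a strong-orthant table of `InTableClass R` (feeds `≥ 0`,
in-shell components `≥ 0` on the coordinate hyperplanes, diagonal back-reaction), for `0 < ε₀ < 1`: a uniformly bounded admissible eternal
solution with per-shell actions `∫‖W_n‖ ≤ log(1/ε₀)/512` is NOT forward (S₁)-surviving — no sign or flux hypothesis (the class forces
`F_k ≥ 0`).
[cite: Tao2016AveragedNS, §1.2, §4 Thm. 4.2 (statement shape), Lemma 4.1 (4.8)–(4.10), §6.4; this file] -/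
theorem not_survivingFwd_of_orthant_logAction {R ε₀ νh : ℝ} (hε : 0 < ε₀) (hε1 : ε₀ < 1)
    {α : Fin 4 → Fin 4 → Fin 4 → ℤ × ℤ × ℤ → ℝ} (hα : InTableClass R α)
    (hA : ∀ (i : Fin 4) (y : Em 4), 0 ≤ tableA α y i)
    (hQ : ∀ (i : Fin 4) (x : Em 4), x i = 0 → 0 ≤ tableQ α x i)
    (hB : ∀ (i : Fin 4) (z x : Em 4), x i = 0 → tableB α z x i = 0)
    {W : ℤ → ℝ → Em 4} (hW : IsEternalVisc ε₀ νh α W) (hU : UniformBound W)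
    (hM : ∀ n, ∫ s, ‖W n s‖ ≤ Real.log (1 / ε₀) / 512) : ¬ EternalSurvivingFwd 1 ε₀ W :=
  not_survivingFwd_of_upwardFlux_logAction hε hε1 hα hW hU (fun k s => physFlux_nonneg hε hW hA hQ hB k s) hM

/-- **Survival on a strong-orthant table costs logarithmic action** (any `ν̂ ≥ 0`): a SURVIVING uniformly bounded admissible eternal solution of a
strong-orthant table of `InTableClass R`, `0 < ε₀ < 1`, carries action `> log(1/ε₀)/512` on some shell.
[cite: Tao2016AveragedNS, §1.2, §4 Thm. 4.2 (statement shape), §6.4; this file] -/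
theorem exists_action_gt_log_of_survivingFwd_orthant {R ε₀ νh : ℝ} (hε : 0 < ε₀) (hε1 : ε₀ < 1)
    {α : Fin 4 → Fin 4 → Fin 4 → ℤ × ℤ × ℤ → ℝ} (hα : InTableClass R α)
    (hA : ∀ (i : Fin 4) (y : Em 4), 0 ≤ tableA α y i)
    (hQ : ∀ (i : Fin 4) (x : Em 4), x i = 0 → 0 ≤ tableQ α x i)
    (hB : ∀ (i : Fin 4) (z x : Em 4), x i = 0 → tableB α z x i = 0)
    {W : ℤ → ℝ → Em 4} (hW : IsEternalVisc ε₀ νh α W) (hU : UniformBound W) (hS : EternalSurvivingFwd 1 ε₀ W) :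
    ∃ n : ℤ, Real.log (1 / ε₀) / 512 < ∫ s, ‖W n s‖ := by
  by_contra h
  push Not at h
  exact not_survivingFwd_of_orthant_logAction hε hε1 hα hA hQ hB hW hU h hS

/-- **THE STRONG-ORTHANT SLICE OF K1ᵛ(1)** in the binder shape of `TaoCascade.NoSurvivingEternalViscBdd R 1` (threshold `εs = 1/2`): for all
`ε₀ ∈ (0, 1/2]`, no table of `InTableClass R` satisfying the unconditional Kamke condition carries a uniformly bounded admissible eternal solution
with covariant viscosity (any `ν̂ ≥ 0`) and per-shell actions `≤ log(1/ε₀)/512` that is forward (S₁)-surviving.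
[cite: Tao2016AveragedNS, §1.2, §4 Thm. 4.2 (statement shape), Lemma 4.1 (4.8)–(4.10), §6.4; this file] -/
theorem noSurvivingEternalViscBdd_rung_orthant (R : ℝ) :
    ∃ εs : ℝ, 0 < εs ∧ ∀ ε₀ : ℝ, 0 < ε₀ → ε₀ ≤ εs →
      ∀ α : Fin 4 → Fin 4 → Fin 4 → ℤ × ℤ × ℤ → ℝ, InTableClass R α →
        (∀ (Y : Fin 4 → ℤ → ℝ → ℝ) (τ δ : ℝ), 0 < δ → ∀ (i : Fin 4) (n : ℤ), Y i n τ = 0 →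
            0 ≤ quadTerm δ α Y i n τ) →
        ∀ (νh : ℝ) (W : ℤ → ℝ → Em 4), IsEternalVisc ε₀ νh α W → UniformBound W →
          (∀ n, ∫ s, ‖W n s‖ ≤ Real.log (1 / ε₀) / 512) → ¬ EternalSurvivingFwd 1 ε₀ W := by
  refine ⟨1 / 2, by norm_num, fun ε₀ hε hle α hα hK νh W hW hU hM => ?_⟩
  obtain ⟨hA, hQ, hB⟩ := (quasiPositive_iff_strongOrthant α).1 hK
  exact not_survivingFwd_of_orthant_logAction hε (by linarith) hα hA hQ hB hW hU hM

/-- **THE STRONG-ORTHANT SLICE OF (ρ0)** in the binder shape of `TaoCascade.NoSurvivingEternalBdd R 1`, WITHOUT the `UniformBound` binder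
(automatic for inviscid admissible eternal solutions of cancelling strong-orthant tables, `uniformBound_of_orthant`): for all `ε₀ ∈ (0, 1/2]`,
no Kamke table of `InTableClass R` carries an admissible INVISCID eternal solution with per-shell actions `≤ log(1/ε₀)/512` that is forward
(S₁)-surviving.
[cite: Tao2016AveragedNS, §1.2, §4 Thm. 4.2 (statement shape), Lemma 4.1 (4.8)–(4.10), §6.4; this file] -/
theorem noSurvivingEternalBdd_rung_orthant (R : ℝ) :
    ∃ εs : ℝ, 0 < εs ∧ ∀ ε₀ : ℝ, 0 < ε₀ → ε₀ ≤ εs →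
      ∀ α : Fin 4 → Fin 4 → Fin 4 → ℤ × ℤ × ℤ → ℝ, InTableClass R α →
        (∀ (Y : Fin 4 → ℤ → ℝ → ℝ) (τ δ : ℝ), 0 < δ → ∀ (i : Fin 4) (n : ℤ), Y i n τ = 0 →
            0 ≤ quadTerm δ α Y i n τ) →
        ∀ W : ℤ → ℝ → Em 4, IsEternal ε₀ α W →
          (∀ n, ∫ s, ‖W n s‖ ≤ Real.log (1 / ε₀) / 512) → ¬ EternalSurvivingFwd 1 ε₀ W := by
  refine ⟨1 / 2, by norm_num, fun ε₀ hε hle α hα hK W hW hM => ?_⟩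
  obtain ⟨hA, hQ, hB⟩ := (quasiPositive_iff_strongOrthant α).1 hK
  exact not_survivingFwd_of_orthant_logAction hε (by linarith) hα hA hQ hB hW.isEternalVisc
    (uniformBound_of_orthant hε hα.2.1 hW hA hQ hB) hM

/-! ## The dyadic member -/

/-- **THE DYADIC MEMBER** (`dyadicTable`, the Katz–Pavlović / Cheskidov chain as an `m = 4` table, `∈ InTableClass 2`): for `0 < ε₀ < 1`, every
admissible INVISCID eternal solution of the renormalised dyadic lattice whose per-shell actions are `≤ log(1/ε₀)/512` is NOT forward
(S₁)-surviving (no sign, boundedness or flux hypothesis: all automatic on this table).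
[cite: Tao2016AveragedNS, §1.2 (the dyadic Katz–Pavlović system), §4 Thm. 4.2 (statement shape), §6.4; BarbatoMorandinRomito2011, §3.1; this file] -/
theorem dyadic_not_survivingFwd_of_logAction {ε₀ : ℝ} (hε : 0 < ε₀) (hε1 : ε₀ < 1) {W : ℤ → ℝ → Em 4}
    (hW : IsEternal ε₀ dyadicTable W) (hM : ∀ n, ∫ s, ‖W n s‖ ≤ Real.log (1 / ε₀) / 512) :
    ¬ EternalSurvivingFwd 1 ε₀ W := by
  obtain ⟨hA, hQ, hB⟩ := (quasiPositive_iff_strongOrthant dyadicTable).1 quasiPositive_dyadicTable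
  have hα : InTableClass 2 dyadicTable := inTableClass_dyadicTable le_rfl
  exact not_survivingFwd_of_orthant_logAction hε hε1 hα hA hQ hB hW.isEternalVisc
    (uniformBound_of_orthant hε hα.2.1 hW hA hQ hB) hM

/-- **Survival on the dyadic member costs logarithmic action**: a forward (S₁)-surviving admissible inviscid eternal solution of `dyadicTable` at
`0 < ε₀ < 1` carries action `> log(1/ε₀)/512` on some shell — unboundedly much as `ε₀ → 0`.
[cite: Tao2016AveragedNS, §1.2, §4 Thm. 4.2 (statement shape), §6.4; BarbatoMorandinRomito2011, §3.1; this file] -/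
theorem dyadic_exists_action_gt_log_of_survivingFwd {ε₀ : ℝ} (hε : 0 < ε₀) (hε1 : ε₀ < 1) {W : ℤ → ℝ → Em 4}
    (hW : IsEternal ε₀ dyadicTable W) (hS : EternalSurvivingFwd 1 ε₀ W) :
    ∃ n : ℤ, Real.log (1 / ε₀) / 512 < ∫ s, ‖W n s‖ := by
  by_contra h
  push Not at h
  exact dyadic_not_survivingFwd_of_logAction hε hε1 hW h hS

/-- **The viscous dyadic member** (any `ν̂ ≥ 0`, with the `UniformBound` binder): same conclusion.
[cite: Tao2016AveragedNS, §1.2, §4 (the viscous equation before Thm. 4.2), §6.4; BarbatoMorandinRomito2011, §3.1; this file] -/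
theorem dyadic_not_survivingFwd_of_logAction_visc {ε₀ νh : ℝ} (hε : 0 < ε₀) (hε1 : ε₀ < 1) {W : ℤ → ℝ → Em 4}
    (hW : IsEternalVisc ε₀ νh dyadicTable W) (hU : UniformBound W)
    (hM : ∀ n, ∫ s, ‖W n s‖ ≤ Real.log (1 / ε₀) / 512) : ¬ EternalSurvivingFwd 1 ε₀ W := by
  obtain ⟨hA, hQ, hB⟩ := (quasiPositive_iff_strongOrthant dyadicTable).1 quasiPositive_dyadicTable
  exact not_survivingFwd_of_orthant_logAction hε hε1 (inTableClass_dyadicTable le_rfl) hA hQ hB hW hU hM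

end Summit.NavierStokesRegularity.NavierStokesRegularity.Theorems.NoSurvivingEternalViscBddOne.UpwardFlux

end
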